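import Summits.QuantumAdvantage.QuantumAdvantage.Theorems.CharDialSegmentMovesC
import Summits.QuantumAdvantage.QuantumAdvantage.Theorems.CharDialJLinPeel
import HarnessLib

/-!
# CharDial — segment moves, part D: the comb family (generic form lemmas, subset sums, definitions)

Support for `CharDial.WalkHardFJLinOdd` (stmt-QuantumAdvantage-32604), continuing part C.  Part C's dense family has all its forms EQUAL (rank
one), hence lies inside the proved rank dial (`charDial_rankOneHardJLinOdd`, `cubeRank_hard`); and rank is a property of a PRESENTATION, not of a
strategy.  The COMB family `combY p n`: cuts come in `B = ⌊(n+1)/K⌋` blocks of `K = p·(8 log₂ n + 9)` consecutive cuts, block `b` reads the comb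
`{i ≡ b (mod B)}` through the popcount form mod `p` and the shifts `[S_b(u) = g (mod p)]`, later cuts are dead.  This part: generic form lemmas
(`form_swap`, `form_update`, `form_setTrue`), the subset-sum covering lemma `subsetSum_surj` (Cauchy–Davenport for the sets `{0, c_j}`), the
family, its natural presentation `combData` (`combData_strat`, `combY_jlin`) and the junta-sensitivity lemma `combY_not_junta`.  Part E: the HIGH
side; part F: presentation rigidity and the escape from the rank dial.  All statements Prop-free.
-/

set_option autoImplicit false

namespace Summit.QuantumAdvantage.AdviceFreeQNC0.JLinPeel.SegMove

open Finset
open Summit.QuantumAdvantage.AdviceFreeQNC0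

variable {n : ℕ} {p : ℕ}

/-! #### generic form lemmas -/

/-- general swap law for forms: an adjacent swap of two different bits moves `form a` by `±(a_t − a_s)`. -/
theorem form_swap (a : Fin n → ZMod p) (u : Fin n → Bool) (s t : Fin n) (hst : t.val = s.val + 1) (hne : u s ≠ u t) :
    form a (segCompl u s.val (s.val + 2)) = form a u + (if u s = true then a t - a s else a s - a t) := by
  rw [form_segCompl]
  congr 1
  have hst' : s ≠ t := fun h => by rw [h] at hst; omega
  rw [Finset.sum_eq_add s t hst']
  · have hs : (s.val ≤ s.val ∧ s.val < s.val + 2) := ⟨le_rfl, by omega⟩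
    have ht : (s.val ≤ t.val ∧ t.val < s.val + 2) := ⟨by omega, by omega⟩
    simp only [hs, ht, and_self, if_true]
    rcases Bool.eq_false_or_eq_true (u s) with hus | hus
    · have hut : u t = false := by
        rcases Bool.eq_false_or_eq_true (u t) with h' | h'
        · exact absurd (hus.trans h'.symm) hne
        · exact h'
      simp [hus, hut]; ring
    · have hut : u t = true := by
        rcases Bool.eq_false_or_eq_true (u t) with h' | h'
        · exact h'
        · exact absurd (hus.trans h'.symm) hne
      simp [hus, hut]; ring
  · intro c _ hc
    have : ¬ (s.val ≤ c.val ∧ c.val < s.val + 2) := by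
      rintro ⟨h1, h2⟩
      rcases hc with ⟨hcs, hct⟩
      have : c.val = s.val ∨ c.val = s.val + 1 := by omega
      rcases this with h | h
      · exact hcs (Fin.ext h)
      · exact hct (Fin.ext (by omega))
    rw [if_neg this]
  · intro h; exact absurd (mem_univ s) h
  · intro h; exact absurd (mem_univ t) h

/-- form of a one-bit update. -/
theorem form_update (a : Fin n → ZMod p) (u : Fin n → Bool) (j : Fin n) (bv : Bool) :
    form a (Function.update u j bv) = form a u - (if u j = true then a j else 0) + (if bv = true then a j else 0) := by
  unfold form
  rw [← Finset.add_sum_erase univ _ (mem_univ j), ← Finset.add_sum_erase univ (fun i => if u i = true then a i else 0) (mem_univ j)]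
  have hrest : ∑ i ∈ univ.erase j, (if Function.update u j bv i = true then a i else 0) =
      ∑ i ∈ univ.erase j, (if u i = true then a i else 0) := by
    refine sum_congr rfl fun i hi => ?_
    rw [Function.update_of_ne (ne_of_mem_erase hi)]
  rw [hrest, Function.update_self]
  ring

/-- a bit with coefficient zero does not move the form. -/
theorem form_update_of_zero (a : Fin n → ZMod p) (u : Fin n → Bool) (j : Fin n) (ha : a j = 0) (bv : Bool) :
    form a (Function.update u j bv) = form a u := by
  rw [form_update]; simp [ha]

/-- setting a set `S` of currently-false bits to true adds `Σ_{j ∈ S} a_j`. -/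
theorem form_setTrue (a : Fin n → ZMod p) (u : Fin n → Bool) (S : Finset (Fin n)) (hS : ∀ j ∈ S, u j = false) :
    form a (fun k => if k ∈ S then true else u k) = form a u + ∑ j ∈ S, a j := by
  unfold form
  have h1 : ∀ k : Fin n, (if (if k ∈ S then true else u k) = true then a k else 0) =
      (if u k = true then a k else 0) + (if k ∈ S then a k else 0) := by
    intro k
    by_cases hk : k ∈ S
    · simp [hk, hS k hk]
    · simp [hk]
  simp_rw [h1]
  rw [sum_add_distrib, Fintype.sum_ite_mem]

/-- **subset sums of `≥ p − 1` non-zero elements of `𝔽_p` reach every residue** (Cauchy–Davenport for the sets `{0, c_j}`). -/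
theorem subsetSum_surj [hp : Fact p.Prime] {ι : Type*} [DecidableEq ι] (c : ι → ZMod p) (T : Finset ι)
    (hT : ∀ j ∈ T, c j ≠ 0) (hcard : p ≤ T.card + 1) (σ r : ZMod p) : ∃ S ⊆ T, σ + ∑ j ∈ S, c j = r := by
  classical
  -- `reach T` = the set of subset sums; claim `min p (|T|+1) ≤ |reach T|`
  let reach : Finset ι → Finset (ZMod p) := fun T => T.powerset.image fun S => ∑ j ∈ S, c j
  have hmono : ∀ (a : ι) (T : Finset ι), reach T ⊆ reach (insert a T) := by
    intro a T x hx
    rcases mem_image.1 hx with ⟨S, hS, rfl⟩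
    exact mem_image.2 ⟨S, mem_powerset.2 ((mem_powerset.1 hS).trans (subset_insert a T)), rfl⟩
  have hshift : ∀ (a : ι) (T : Finset ι), a ∉ T → ∀ x ∈ reach T, x + c a ∈ reach (insert a T) := by
    intro a T haT x hx
    rcases mem_image.1 hx with ⟨S, hS, rfl⟩
    have hSa : a ∉ S := fun h => haT (mem_powerset.1 hS h)
    refine mem_image.2 ⟨insert a S, mem_powerset.2 (insert_subset_insert a (mem_powerset.1 hS)), ?_⟩
    rw [sum_insert hSa, add_comm]
  have hzero : ∀ T : Finset ι, (0 : ZMod p) ∈ reach T := fun T =>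
    mem_image.2 ⟨∅, mem_powerset.2 (empty_subset T), by simp⟩
  -- a non-empty subset of `𝔽_p` closed under `+ c`, `c ≠ 0`, is everything
  have hclosed : ∀ (X : Finset (ZMod p)) (c₀ : ZMod p), c₀ ≠ 0 → (0 : ZMod p) ∈ X → (∀ x ∈ X, x + c₀ ∈ X) → X = univ := by
    intro X c₀ hc₀ h0 hX
    have hk : ∀ k : ℕ, ((k : ZMod p) * c₀) ∈ X := by
      intro k
      induction k with
      | zero => simpa using h0
      | succ k ih =>
        have := hX _ ih
        push_cast
        rw [add_mul, one_mul]; exact this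
    ext r
    simp only [mem_univ, iff_true]
    have := hk (r * c₀⁻¹).val
    rwa [ZMod.natCast_zmod_val, inv_mul_cancel_right₀ hc₀] at this
  have hgrow : ∀ T : Finset ι, (∀ j ∈ T, c j ≠ 0) → min p (T.card + 1) ≤ (reach T).card := by
    intro T
    induction T using Finset.induction_on with
    | empty =>
      intro _
      have : (reach ∅).card = 1 := by
        show ((∅ : Finset ι).powerset.image fun S => ∑ j ∈ S, c j).card = 1
        rw [powerset_empty, image_singleton, card_singleton]
      rw [this]; exact min_le_right _ _
    | insert a T haT ih =>
      intro hT
      have hca : c a ≠ 0 := hT a (mem_insert_self a T)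
      have ih' := ih fun j hj => hT j (mem_insert_of_mem hj)
      rw [card_insert_of_notMem haT]
      by_cases hfull : p ≤ (reach T).card
      · exact le_trans (min_le_left _ _) (le_trans hfull (card_le_card (hmono a T)))
      · -- not full: the shift by `c a` leaves `reach T`
        have hex : ∃ x ∈ reach T, x + c a ∉ reach T := by
          by_contra hne
          push Not at hne
          have := hclosed (reach T) (c a) hca (hzero T) hne
          rw [this, card_univ, ZMod.card] at hfull
          exact hfull le_rfl
        obtain ⟨x, hx, hxa⟩ := hex
        have hsub : insert (x + c a) (reach T) ⊆ reach (insert a T) := by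
          intro y hy
          rcases mem_insert.1 hy with rfl | hy
          · exact hshift a T haT x hx
          · exact hmono a T hy
        have := card_le_card hsub
        rw [card_insert_of_notMem hxa] at this
        omega
  have hfull : reach T = univ := by
    rw [← Finset.card_eq_iff_eq_univ, ZMod.card]
    exact le_antisymm (by simpa [ZMod.card] using card_le_univ (reach T)) (by have := hgrow T hT; omega)
  have hr : r - σ ∈ reach T := by rw [hfull]; exact mem_univ _
  rcases mem_image.1 hr with ⟨S, hS, hsum⟩
  exact ⟨S, mem_powerset.1 hS, by rw [hsum]; ring⟩

/-! #### the comb family -/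

/-- residue systems per block, `= 2·(4(log₂ n + 1)) + 1` (twice the dial threshold plus one). -/
def dialM (n : ℕ) : ℕ := 8 * Nat.log 2 n + 9

/-- `dialM n = 2·(4(log₂ n + 1)) + 1`: twice the dial threshold plus one. -/
theorem dialM_eq (n : ℕ) : dialM n = 2 * (4 * (Nat.log 2 n + 1)) + 1 := by unfold dialM; ring

/-- cuts per block. -/
def combK (p n : ℕ) : ℕ := p * dialM n

/-- number of full blocks = number of combs. -/
def combB (p n : ℕ) : ℕ := (n + 1) / combK p n

/-- the comb `b` (coordinates `≡ b (mod B)`). -/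
def combClass (n B b : ℕ) : Finset (Fin n) := univ.filter fun i : Fin n => i.val % B = b

/-- coefficients of comb `b`: the indicator of the comb. -/
def combCoef (p B b : ℕ) (i : Fin n) : ZMod p := if i.val % B = b then 1 else 0

/-- the comb family: cut `g` of block `b = g / K < B` outputs `[S_b(u) = g (mod p)]`, later cuts are dead. -/
def combY (p n : ℕ) : Fin (n + 1) → (Fin n → Bool) → Bool := fun g u =>
  decide (g.val < combB p n * combK p n ∧ form (combCoef p (combB p n) (g.val / combK p n)) u = ((g : ℕ) : ZMod p))

/-- the natural presentation of the comb family (empty juntas). -/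
def combData (p n : ℕ) : JLinData p n where
  J := fun _ => ∅
  a := fun g => combCoef p (combB p n) (g.val / combK p n)
  h := fun g _ s => decide (g.val < combB p n * combK p n ∧ s = ((g : ℕ) : ZMod p))
  hJ := by intro g u v _ s; rfl

/-- the natural presentation presents the comb family, definitionally. -/
theorem combData_strat (p n : ℕ) : (combData p n).strat = combY p n := rfl

/-- the comb family satisfies the CharDial hypothesis (empty junta), in the tree's words. -/
theorem combY_jlin (p n : ℕ) : ∀ g : Fin (n + 1), ∃ J : Finset (Fin n), J.card ≤ Nat.log 2 n ∧ ∃ a : Fin n → ZMod p,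
    ∃ h : (Fin n → Bool) → ZMod p → Bool, (∀ u v : Fin n → Bool, (∀ i ∈ J, u i = v i) → ∀ s, h u s = h v s) ∧
      ∀ u, combY p n g u = h u (∑ i, if u i then a i else 0) := by
  intro g
  refine ⟨∅, by simp, combCoef p (combB p n) (g.val / combK p n),
    fun _ s => decide (g.val < combB p n * combK p n ∧ s = ((g : ℕ) : ZMod p)), ?_, ?_⟩
  · intro u v _ s
    rfl
  · intro u
    rfl

/-- blocks are non-empty. -/
theorem combK_pos [hp : Fact p.Prime] (n : ℕ) : 0 < combK p n := by
  unfold combK dialM; exact Nat.mul_pos hp.out.pos (by omega)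

/-- the full blocks fit into the `n + 1` cuts. -/
theorem combB_mul_le (p n : ℕ) : combB p n * combK p n ≤ n + 1 := Nat.div_mul_le_self _ _

/-- adjacent positions lie on different combs (`B ≥ 2`). -/
theorem succ_mod_ne {B : ℕ} (hB : 2 ≤ B) (s : ℕ) : (s + 1) % B ≠ s % B := by
  intro h
  have h1 := Nat.sub_mod_eq_zero_of_mod_eq h
  rw [Nat.add_sub_cancel_left, Nat.mod_eq_of_lt (by omega : 1 < B)] at h1
  exact one_ne_zero h1

/-- flipping a comb bit moves the comb form by `±1`. -/
theorem form_comb_update_mem {B b : ℕ} (u : Fin n → Bool) (j : Fin n) (hj : j.val % B = b) :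
    form (combCoef p B b) (Function.update u j (!u j)) =
      if u j = true then form (combCoef p B b) u - 1 else form (combCoef p B b) u + 1 := by
  rw [form_update]
  have : combCoef p B b j = 1 := by unfold combCoef; rw [if_pos hj]
  rw [this]
  cases u j <;> simp

/-- flipping an off-comb bit does not move the comb form. -/
theorem form_comb_update_not_mem {B b : ℕ} (u : Fin n → Bool) (j : Fin n) (hj : j.val % B ≠ b) (bv : Bool) :
    form (combCoef p B b) (Function.update u j bv) = form (combCoef p B b) u := by
  apply form_update_of_zero
  unfold combCoef; rw [if_neg hj]

/-- size of a comb: at least `⌊n / B⌋`. -/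
theorem card_combClass_ge {B b : ℕ} (hB : 0 < B) (hb : b < B) : n / B ≤ (combClass n B b).card := by
  set m := n / B
  have hmB : m * B ≤ n := Nat.div_mul_le_self n B
  have hbound : ∀ k : Fin m, b + k.val * B < n := by
    intro k
    have hk : (k.val + 1) * B ≤ m * B := Nat.mul_le_mul_right B (by have := k.isLt; omega)
    rw [Nat.add_mul, one_mul] at hk
    omega
  let f : Fin m → Fin n := fun k => ⟨b + k.val * B, hbound k⟩
  have hcard : (univ : Finset (Fin m)).card = m := by simp
  rw [← hcard]
  refine Finset.card_le_card_of_injOn f ?_ ?_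
  · intro k _
    rw [mem_coe, combClass, mem_filter]
    exact ⟨mem_univ _, by show (b + k.val * B) % B = b; rw [Nat.add_mul_mod_self_right, Nat.mod_eq_of_lt hb]⟩
  · intro k _ k' _ hkk
    have h1 : b + k.val * B = b + k'.val * B := by
      have := congrArg Fin.val hkk
      simpa [f] using this
    exact Fin.ext (Nat.eq_of_mul_eq_mul_right hB (by omega))

/-- every residue is a value of a comb form (comb of size `≥ p − 1`). -/
theorem exists_comb_form_eq [hp : Fact p.Prime] {B b : ℕ} (hR : p ≤ (combClass n B b).card + 1) (r : ZMod p) :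
    ∃ u : Fin n → Bool, form (combCoef p B b) u = r := by
  haveI : NeZero p := ⟨hp.out.ne_zero⟩
  have hrv : r.val < p := ZMod.val_lt r
  obtain ⟨S, hS, hScard⟩ := Finset.exists_subset_card_eq (s := combClass n B b) (n := r.val) (by omega)
  refine ⟨fun i => decide (i ∈ S), ?_⟩
  unfold form
  have h1 : ∀ i : Fin n, (if decide (i ∈ S) = true then combCoef p B b i else 0) = if i ∈ S then (1 : ZMod p) else 0 := by
    intro i
    by_cases hi : i ∈ S
    · have hc : i.val % B = b := (mem_filter.1 (hS hi)).2
      simp [hi, combCoef, hc]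
    · simp [hi]
  simp_rw [h1]
  rw [Fintype.sum_ite_mem, sum_const, nsmul_eq_mul, mul_one, hScard, ZMod.natCast_zmod_val]

/-- **a comb cut is not a junta off its comb**: if `j ∈ R_b ∖ J'` then cut `g` of block `b` is not `J'`-determined. -/
theorem combY_not_junta [hp : Fact p.Prime] (g : Fin (n + 1)) (hg : g.val < combB p n * combK p n) (J' : Finset (Fin n))
    (j : Fin n) (hj : j.val % combB p n = g.val / combK p n) (hjJ : j ∉ J')
    (hR : p ≤ (combClass n (combB p n) (g.val / combK p n)).card + 1) :
    ¬ ∀ u v : Fin n → Bool, (∀ i ∈ J', u i = v i) → combY p n g u = combY p n g v := by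
  haveI : Fact (1 < p) := ⟨hp.out.one_lt⟩
  intro hjun
  obtain ⟨u, hu⟩ := exists_comb_form_eq (n := n) hR ((g : ℕ) : ZMod p)
  have hagree : ∀ i ∈ J', u i = Function.update u j (!u j) i := by
    intro i hi
    rw [Function.update_of_ne (ne_of_mem_of_not_mem hi hjJ)]
  have h := hjun u _ hagree
  have hform := form_comb_update_mem (p := p) u j hj
  unfold combY at h
  rw [hform, hu] at h
  revert h
  cases u j <;> simp [hg]

end Summit.QuantumAdvantage.AdviceFreeQNC0.JLinPeel.SegMove
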